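import Literature.NumberTheory.EllipticCurves.BurungaleKobayashiNakamuraOta2026.AnticyclotomicEllipticUnitClass
import Literature.NumberTheory.DiophantineGeometry.EntireContinuation
import HarnessLib

/-!
# O11 (CM, ramified prime): the explicit reciprocity law of an anticyclotomic elliptic-unit datum READ
# FROM THE WEIGHT-ONE HALF-PLANE — the predicate `HasReciprocityFrom` (planner D121 (b)(i), repair (R-a)
# of DEFECT-2 «continuation half-plane»; cell `bsd-cm`, seat `bsd-cm-k7r-c4` g6; DEFINITION ONLY,
# append-only, no new datum structure, nothing asserted)

HONEST FRAMING. The field `erl` of the tree's datum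
`Literature.NumberTheory.EllipticCurves.BurungaleKobayashiNakamuraOta2026.EllipticUnitClassData`
([BKNO] Prop. 4.10 at `k = 0`: `exp*_{χ,ω}(χ(loc_𝔭 z)) = L(φχ, 1)/Ω`) quantifies its `L`-value over
`hL : LFunction.HasEntireContinuation (heckeLFunction (φ * χ))`, an entire continuation agreeing with the
raw Euler product on `re s > 1`. For the WEIGHT-(1,0) character `φ` of a CM elliptic curve (pinned by
`heckeLFunction φ s = W.LSeries s` on `re s > 3/2`, Deuring) that product converges absolutely only on
`re s > 3/2`; on the strip `1 < re s ≤ 3/2` the tree's `heckeLFunction` is the junk value of `tprod`, so no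
entire function can match it and the type of `hL` is EMPTY: `erl` is vacuous at every pinned datum
(DEFECT-2: seat k7r-c4 memo MEMO-k7r-c4-g6-CONTINUATION.md, k7r-c2 g5 and k7r-c3 g7 independently;
referee countersign REFEREE-COUNTERSIGN-DEFECT2-G39; planner D121; kernel certificate
`…Theorems.RamifiedSevenEllipticUnits.HvanAnatomy` §2–§3). This file states the SAME reciprocity law with the
continuation taken from the weight-one half-plane, as a PREDICATE on the existing datum (no new structure,
hence no crux twin): `HasReciprocityFrom D` — for every layer `n`, every finite-order `χ` of level `≤ n`
with avatar `r` (`IsAcCharacter`), and GIVEN an entire continuation of `heckeLFunction (φ * χ)` FROM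
`re s > 3/2` (the tree's `DiophantineGeometry.LFunction.HasEntireContinuationFrom (3/2)`), the value
`δ n r (z n)` is `ι⁻¹(L(φχ, 1)/Ω)` with `L(φχ, 1) := entireContinuationFrom (3/2) (heckeLFunction (φχ)) 1`
(the unique such continuation, `entireContinuationFrom_eq_of_mem`). At `χ = 𝟙` the continuation IS
`W.entireLFunction` under the pin (`HvanAnatomy.entireContinuationFrom_eq_entireLFunction_of_pin`, seat
k7r-c3 g7), so the predicate is SATISFIABLE and carries the intended content; the consumer (B1′) and the
non-vacuity exercise live Theorems-side (`…RamifiedSevenEllipticUnitsBottomClassReciprocityFrom`).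
NOT a Literature edit: the datum and its old field are untouched (the old `erl` stays, vacuous and idle).
[BKNO] is an unrefereed preprint; nothing of it is asserted here.

References: [BKNO] A. Burungale, S. Kobayashi, K. Nakamura, K. Ota, arXiv:2608.06879v1 (2026) Prop. 4.10,
§4.4 (4.10), Lemma 7.1, Thm. 7.2 [BurungaleKobayashiNakamuraOta2026]; J. Neukirch, *Algebraic Number
Theory* VII §5 (continuation from a half-plane) [NeukirchANT1999]; J. Silverman, *Advanced Topics* II
Thm. 10.5 (Deuring, `L(E/ℚ, s) = L(φ, s)`) [SilvermanATAEC1994].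
-/

noncomputable section

open scoped Classical

open WeierstrassCurve NumberField IsDedekindDomain Field
  Literature.NumberTheory.EllipticCurves
  Literature.NumberTheory.GaloisRepresentations
  Literature.NumberTheory.EllipticCurves.BurungaleKobayashiNakamuraOta2026
  Literature.NumberTheory.DiophantineGeometry

namespace Summit.BirchSwinnertonDyer.Rank1Residual.X12.O11

variable {W : WeierstrassCurve ℚ} {p : ℕ} [Fact p.Prime] {K : Type} [Field K] [NumberField K]
  {𝔭 : HeightOneSpectrum (𝓞 K)} {κ : ZpExtension K p} {γ : absoluteGaloisGroup K}
  {ι : PadicAlgCl p ≃+* ℂ} {φ : HeckeCharacter K} {Ω : ℂ} {𝓔 : AcDualExpSystem W p K 𝔭 κ ι}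
  [W.IsElliptic]

/-- **The explicit reciprocity law of the datum `D`, read from the weight-one half-plane `re s > 3/2`
(repair (R-a) of DEFECT-2; planner D121 (b)(i)).** For every layer `n`, every finite-order Hecke character
`χ` of level `≤ n` with `p`-adic avatar `r` (`IsAcCharacter ι κ n χ r`), and GIVEN an entire continuation
of `s ↦ heckeLFunction (φ * χ) s` from the half-plane `re s > 3/2` (where the weight-one Euler product
converges; `LFunction.HasEntireContinuationFrom (3/2)`): the `χ`-component of the dual exponential of the
level-`n` class is the central value over the period,
`𝓔.δ n r (D.z n) = ι⁻¹(entireContinuationFrom (3/2) (heckeLFunction (φ * χ)) 1 / Ω)`. This is [BKNO]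
Prop. 4.10 at `k = 0` (as the field `EllipticUnitClassData.erl`, whose threshold-`1` continuation binder is
empty at weight one) stated in the only currency in which its antecedent is inhabited. A PREDICATE on the
datum; nothing asserted; the old field is untouched. [cite: BurungaleKobayashiNakamuraOta2026, Prop. 4.10 and §4.4 (4.10), Lemma 7.1 (arXiv:2608.06879 pp. 31–32, 40) (claim; preprint; shape only)]
[cite: NeukirchANT1999, Ch. VII §5 (continuation from a half-plane; shape only)] -/
def HasReciprocityFrom (D : EllipticUnitClassData W p K 𝔭 κ γ ι φ Ω 𝓔) : Prop :=
  ∀ (n : ℕ) (χ : HeckeCharacter K) (r : FramedGaloisRep K (PadicAlgCl p) 1), IsAcCharacter ι κ n χ r →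
    LFunction.HasEntireContinuationFrom (3 / 2) (heckeLFunction (φ * χ)) →
      𝓔.δ n r (D.z n) =
        ((ι.symm (LFunction.entireContinuationFrom (3 / 2) (heckeLFunction (φ * χ)) 1 / Ω) :
          PadicAlgCl p) : ℂ_[p])

/-- The level-`0` clause of `HasReciprocityFrom` in the shape consumed by (B1′)
(`HvanAnatomy.bottom_mem_compactSelmerOver_of_erl'`, seat k7r-c3 g7): at every level-`0` pair `(χ, r)`
WITH a continuation from `re s > 3/2`, `δ 0 r (z 0) = ι⁻¹(L(φχ, 1)/Ω)`. [cite: BurungaleKobayashiNakamuraOta2026, Prop. 4.10 and Lemma 7.1 (arXiv:2608.06879 pp. 31, 40) (claim; preprint; shape only)] -/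
theorem HasReciprocityFrom.level_zero {D : EllipticUnitClassData W p K 𝔭 κ γ ι φ Ω 𝓔}
    (hR : HasReciprocityFrom D) (χ : HeckeCharacter K) (r : FramedGaloisRep K (PadicAlgCl p) 1)
    (hχ : IsAcCharacter ι κ 0 χ r)
    (hL : LFunction.HasEntireContinuationFrom (3 / 2) (heckeLFunction (φ * χ))) :
    𝓔.δ 0 r (D.z 0) =
      ((ι.symm (LFunction.entireContinuationFrom (3 / 2) (heckeLFunction (φ * χ)) 1 / Ω) :
        PadicAlgCl p) : ℂ_[p]) :=
  hR 0 χ r hχ hL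

end Summit.BirchSwinnertonDyer.Rank1Residual.X12.O11

end
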